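import Summits.NavierStokesRegularity.NavierStokesRegularity.Theorems.LerayQuarterDissipationRecurrentDissipativeLiouvilleCriticalRecurrent
import Summits.NavierStokesRegularity.NavierStokesRegularity.Theorems.LerayQuarterDissipationFiniteDissipationLiouvillePersistenceSeq
import Summits.NavierStokesRegularity.NavierStokesRegularity.Theorems.LerayQuarterDissipationFiniteDissipationLiouvillePortrait
import HarnessLib

/-!
# Crux `FiniteDissipationLiouville` (stmt-NavierStokesRegularity-22144), line `birth`:
# the DOUBLY CRITICAL element — least dissipation constant, then least Type-I constant

Theorems file of route `LerayQuarterDissipation` (lead ns-lqd-lead g7), `--supports 22144`.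
Navier–Stokes regularity is NOT proved by anything here; no summit is.

ns-lqd-p1's critical element (`CriticalElement.exists_recurrent_criticalElement`) minimises the
dissipation constant `K` among singular members with a given Type-I constant `C`. The Type-I
constant can be minimised as well, at the critical dissipation level, by the same compactness
(`Compactness.seqLimit`, `law_of_seqLimit`, `persistent_singularity_seq`; the pointwise bound
`‖w_k(t,x)‖ ≤ C_k/√(−t)` passes to the limit):

* `IsTypeIAncientMild.of_hasTypeITimeDecay`, `IsTypeIAncientMild.mono_const` — bookkeeping: the
  class with a smaller / larger Type-I constant;
* `exists_minimal_typeI_constant` — for a singular member of `𝒟_{C,K_c}` there is a least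
  `C_* ∈ [1, C]` admitting a singular member of `𝒟_{C_*,K_c}` (attained; `C_* ≥ 1` by the tree's
  `typeI_ancient_eq_zero_of_rate_lt_one` via `Birth.one_le_typeI_const_of_singular`);
* `exists_doublyCritical_recurrent` — **normal form of a counterexample, both constants critical**:
  if the crux fails at `(C, K)` there are `K_c ∈ (K₀, K]`, `C_* ∈ [1, C]` and a member
  `w ∈ 𝒟_{C_*,K_c}`, singular at the apex and UNIFORMLY RECURRENT, such that NO singular member
  exists in `𝒟_{C,K'}` for `K' < K_c` nor in `𝒟_{C',K_c}` for `C' < C_*`, and `w` near-saturates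
  `K_c` in every long backward log-window. Both suprema `sup_s √(−s)∫‖∇w(s)‖² = K_c` and
  `sup_{t,x} √(−t)‖w(t,x)‖ = C_*` are then EXACT (`exists_slice_gt_of_minimal` and
  `exists_point_gt_of_minimalC` below).

Portrait value: a refutation of the crux may be normalised to a doubly critical recurrent element;
every perturbative lever must therefore fail at BOTH thresholds simultaneously. No definitions;
standard axioms.
-/

noncomputable section

-- the summit and its single sub-problem share the name (CONVENTIONS §1), as in every Theorems file
set_option linter.dupNamespace false

namespace Summit.NavierStokesRegularity.NavierStokesRegularity.Theorems.FiniteDissipationLiouville.CriticalElement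

open MeasureTheory Set Filter Topology Metric Function
open Literature.Analysis Literature.Analysis.FluidPDE
open Summit.NavierStokesRegularity.NavierStokesRegularity.Theorems.FiniteDissipationLiouville
open scoped ENNReal NNReal

/-- Replacing the Type-I constant by any constant for which the temporal bound holds. -/
theorem _root_.Literature.Analysis.FluidPDE.IsTypeIAncientMild.of_hasTypeITimeDecay {C C' : ℝ}
    {u : ℝ → EuclideanSpace ℝ (Fin 3) → EuclideanSpace ℝ (Fin 3)} (h : IsTypeIAncientMild C u)
    (h' : HasTypeITimeDecay C' u) : IsTypeIAncientMild C' u :=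
  ⟨h.contDiffOn, fun _ ht => h.isDivFree ht, fun _ _ hst ht x => h.mild_eq hst ht x, h'⟩

/-- The class grows with the Type-I constant. -/
theorem _root_.Literature.Analysis.FluidPDE.IsTypeIAncientMild.mono_const {C C' : ℝ} (hCC' : C ≤ C')
    {u : ℝ → EuclideanSpace ℝ (Fin 3) → EuclideanSpace ℝ (Fin 3)} (h : IsTypeIAncientMild C u) :
    IsTypeIAncientMild C' u :=
  h.of_hasTypeITimeDecay fun _ ht x => (h.norm_le ht x).trans
    (div_le_div_of_nonneg_right hCC' (Real.sqrt_nonneg _))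

/-- **The least Type-I constant at a given dissipation level is attained.** For a singular member
of `𝒟_{C,K}` there is `C_* ∈ [1, C]` with a singular member of `𝒟_{C_*,K}` and none in `𝒟_{C',K}`
for any `C' < C_*`. -/
theorem exists_minimal_typeI_constant {C K : ℝ}
    {u : ℝ → EuclideanSpace ℝ (Fin 3) → EuclideanSpace ℝ (Fin 3)} (hu : IsTypeIAncientMild C u)
    (hlaw : ∀ s : ℝ, s < 0 → ∫⁻ x, ‖fderiv ℝ (u s) x‖ₑ ^ 2 ≤ ENNReal.ofReal (K / Real.sqrt (-s)))
    (hsing : ∀ r > 0, ∀ M : ℝ, ∃ t ∈ Set.Ioo (-(r ^ 2)) (0 : ℝ),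
      ∃ x ∈ Metric.ball (0 : EuclideanSpace ℝ (Fin 3)) r, M < ‖u t x‖) :
    ∃ Cs : ℝ, 1 ≤ Cs ∧ Cs ≤ C ∧
      (∃ W : ℝ → EuclideanSpace ℝ (Fin 3) → EuclideanSpace ℝ (Fin 3),
        IsTypeIAncientMild Cs W ∧
        (∀ s : ℝ, s < 0 → ∫⁻ x, ‖fderiv ℝ (W s) x‖ₑ ^ 2 ≤ ENNReal.ofReal (K / Real.sqrt (-s))) ∧
        (∀ r > 0, ∀ M : ℝ, ∃ t ∈ Set.Ioo (-(r ^ 2)) (0 : ℝ),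
          ∃ x ∈ Metric.ball (0 : EuclideanSpace ℝ (Fin 3)) r, M < ‖W t x‖)) ∧
      (∀ C' : ℝ, C' < Cs → ∀ w : ℝ → EuclideanSpace ℝ (Fin 3) → EuclideanSpace ℝ (Fin 3),
        IsTypeIAncientMild C' w →
        (∀ s : ℝ, s < 0 → ∫⁻ x, ‖fderiv ℝ (w s) x‖ₑ ^ 2 ≤ ENNReal.ofReal (K / Real.sqrt (-s))) →
        ¬ (∀ r > 0, ∀ M : ℝ, ∃ t ∈ Set.Ioo (-(r ^ 2)) (0 : ℝ),
          ∃ x ∈ Metric.ball (0 : EuclideanSpace ℝ (Fin 3)) r, M < ‖w t x‖)) := by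
  -- admissible Type-I constants below `C`
  set S : Set ℝ := {C' | C' ≤ C ∧ ∃ w : ℝ → EuclideanSpace ℝ (Fin 3) → EuclideanSpace ℝ (Fin 3),
    IsTypeIAncientMild C' w ∧
    (∀ s : ℝ, s < 0 → ∫⁻ x, ‖fderiv ℝ (w s) x‖ₑ ^ 2 ≤ ENNReal.ofReal (K / Real.sqrt (-s))) ∧
    (∀ r > 0, ∀ M : ℝ, ∃ t ∈ Set.Ioo (-(r ^ 2)) (0 : ℝ),
      ∃ x ∈ Metric.ball (0 : EuclideanSpace ℝ (Fin 3)) r, M < ‖w t x‖)} with hS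
  have hCS : C ∈ S := ⟨le_rfl, u, hu, hlaw, hsing⟩
  have hne : S.Nonempty := ⟨C, hCS⟩
  have hbdd : BddBelow S := ⟨1, fun C' hC' => by
    obtain ⟨-, w, hw, -, hsw⟩ := hC'
    exact Birth.one_le_typeI_const_of_singular hw hsw⟩
  set Cs : ℝ := sInf S with hCs
  have hglb : IsGLB S Cs := isGLB_csInf hne hbdd
  have h1 : 1 ≤ Cs := le_csInf hne fun C' hC' => by
    obtain ⟨-, w, hw, -, hsw⟩ := hC'
    exact Birth.one_le_typeI_const_of_singular hw hsw
  refine ⟨Cs, h1, csInf_le hbdd hCS, ?_, fun C' hC' w hw hlw hsw => ?_⟩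
  · -- attainment along a minimising sequence
    obtain ⟨Ck, hanti, -, htend, hmem⟩ := hglb.exists_seq_antitone_tendsto hne
    have hmem' : ∀ n, Ck n ≤ C ∧ ∃ w : ℝ → EuclideanSpace ℝ (Fin 3) → EuclideanSpace ℝ (Fin 3),
        IsTypeIAncientMild (Ck n) w ∧
        (∀ s : ℝ, s < 0 → ∫⁻ x, ‖fderiv ℝ (w s) x‖ₑ ^ 2 ≤ ENNReal.ofReal (K / Real.sqrt (-s))) ∧
        (∀ r > 0, ∀ M : ℝ, ∃ t ∈ Set.Ioo (-(r ^ 2)) (0 : ℝ),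
          ∃ x ∈ Metric.ball (0 : EuclideanSpace ℝ (Fin 3)) r, M < ‖w t x‖) := fun n => by
      have h := hmem n
      rw [hS] at h
      exact h
    choose hCkC w hw hlw hsw using hmem'
    -- common constant `C` along the sequence
    have hwC : ∀ k, IsTypeIAncientMild C (w k) := fun k => (hw k).mono_const (hCkC k)
    obtain ⟨ψ, hψ, W, hW, hunif, hpt, hgrad⟩ := Compactness.seqLimit hwC
    have hψt : Tendsto ψ atTop atTop := hψ.tendsto_atTop
    have hlawW : ∀ s : ℝ, s < 0 →
        ∫⁻ x, ‖fderiv ℝ (W s) x‖ₑ ^ 2 ≤ ENNReal.ofReal (K / Real.sqrt (-s)) :=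
      Compactness.law_of_seqLimit (Kk := fun _ => K) hψt hlw
        (fun ε hε => Eventually.of_forall fun _ => (lt_add_of_pos_right K hε).le) hgrad
    have hsingW := Compactness.persistent_singularity_seq (fun j => hwC (ψ j)) (fun j => hlw (ψ j))
      (fun j => hsw (ψ j)) hW hunif
    -- the Type-I bound with the limiting constant
    have hrate : HasTypeITimeDecay Cs W := by
      intro t ht x
      have hlim1 : Tendsto (fun j => ‖w (ψ j) t x‖) atTop (𝓝 ‖W t x‖) := (hpt t ht x).norm
      have hlim2 : Tendsto (fun j => Ck (ψ j) / Real.sqrt (-t)) atTop (𝓝 (Cs / Real.sqrt (-t))) :=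
        (htend.comp hψt).div_const _
      exact le_of_tendsto_of_tendsto' hlim1 hlim2 fun j => (hw (ψ j)).norm_le ht x
    exact ⟨W, hW.of_hasTypeITimeDecay hrate, hlawW, hsingW⟩
  · -- minimality
    rcases le_or_gt C' C with hle | hgt
    · exact absurd (csInf_le hbdd ⟨hle, w, hw, hlw, hsw⟩) (not_le.2 hC')
    · exact absurd ((csInf_le hbdd hCS).trans_lt hgt) (not_lt.2 hC'.le)

/-- **The sharpness of the critical Type-I constant**: at a `C`-minimal singular member of
`𝒟_{C_*,K}`, for every `C' < C_*` some point has `C'/√(−t) < ‖W(t,x)‖`, i.e.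
`sup √(−t)‖W‖ = C_*` exactly. -/
theorem exists_point_gt_of_minimalC {Cs K : ℝ}
    (hminC : ∀ C' : ℝ, C' < Cs → ∀ v : ℝ → EuclideanSpace ℝ (Fin 3) → EuclideanSpace ℝ (Fin 3),
      IsTypeIAncientMild C' v →
      (∀ s : ℝ, s < 0 → ∫⁻ x, ‖fderiv ℝ (v s) x‖ₑ ^ 2 ≤ ENNReal.ofReal (K / Real.sqrt (-s))) →
      ¬ (∀ r > 0, ∀ M : ℝ, ∃ t ∈ Set.Ioo (-(r ^ 2)) (0 : ℝ),
        ∃ x ∈ Metric.ball (0 : EuclideanSpace ℝ (Fin 3)) r, M < ‖v t x‖))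
    {W : ℝ → EuclideanSpace ℝ (Fin 3) → EuclideanSpace ℝ (Fin 3)} (hW : IsTypeIAncientMild Cs W)
    (hlaw : ∀ s : ℝ, s < 0 → ∫⁻ x, ‖fderiv ℝ (W s) x‖ₑ ^ 2 ≤ ENNReal.ofReal (K / Real.sqrt (-s)))
    (hsing : ∀ r > 0, ∀ M : ℝ, ∃ t ∈ Set.Ioo (-(r ^ 2)) (0 : ℝ),
      ∃ x ∈ Metric.ball (0 : EuclideanSpace ℝ (Fin 3)) r, M < ‖W t x‖)
    {C' : ℝ} (hC' : C' < Cs) :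
    ∃ t : ℝ, t < 0 ∧ ∃ x, C' / Real.sqrt (-t) < ‖W t x‖ := by
  by_contra hcon
  push Not at hcon
  exact hminC C' hC' W (hW.of_hasTypeITimeDecay fun t ht x => hcon t ht x) hlaw hsing

/-- **The doubly critical recurrent element.** There is an absolute `K₀ > 0` such that whenever
some `𝒟_{C,K}` has a singular member, there are `K_c ∈ (K₀, K]`, `C_* ∈ [1, C]` and
`w ∈ 𝒟_{C_*,K_c}`, singular at the apex and uniformly recurrent under the scaling flow, with NO
singular member in `𝒟_{C,K'}` for `K' < K_c` (dissipation-critical, at the original `C`) and NONE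
in `𝒟_{C',K_c}` for `C' < C_*` (Type-I-critical), near-saturating `K_c` in every long backward
log-window. -/
theorem exists_doublyCritical_recurrent :
    ∃ K₀ : ℝ, 0 < K₀ ∧ ∀ (C K : ℝ)
      (u : ℝ → EuclideanSpace ℝ (Fin 3) → EuclideanSpace ℝ (Fin 3)), IsTypeIAncientMild C u →
      (∀ s : ℝ, s < 0 → ∫⁻ x, ‖fderiv ℝ (u s) x‖ₑ ^ 2 ≤ ENNReal.ofReal (K / Real.sqrt (-s))) →
      (∀ r > 0, ∀ M : ℝ, ∃ t ∈ Set.Ioo (-(r ^ 2)) (0 : ℝ),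
        ∃ x ∈ Metric.ball (0 : EuclideanSpace ℝ (Fin 3)) r, M < ‖u t x‖) →
      ∃ (Kc Cs : ℝ) (w : ℝ → EuclideanSpace ℝ (Fin 3) → EuclideanSpace ℝ (Fin 3)),
        K₀ < Kc ∧ Kc ≤ K ∧ 1 ≤ Cs ∧ Cs ≤ C ∧ IsTypeIAncientMild Cs w ∧
        (∀ s : ℝ, s < 0 → ∫⁻ x, ‖fderiv ℝ (w s) x‖ₑ ^ 2 ≤ ENNReal.ofReal (Kc / Real.sqrt (-s))) ∧
        (∀ r > 0, ∀ M : ℝ, ∃ t ∈ Set.Ioo (-(r ^ 2)) (0 : ℝ),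
          ∃ x ∈ Metric.ball (0 : EuclideanSpace ℝ (Fin 3)) r, M < ‖w t x‖) ∧
        (∀ ε > 0, ∀ R > 1, ∃ L > 0, ∀ a : ℝ, ∃ σ ∈ Set.Icc a (a + L),
          ∀ s ∈ Set.Icc (-(R ^ 2)) (-(R⁻¹) ^ 2),
          ∀ y ∈ Metric.closedBall (0 : EuclideanSpace ℝ (Fin 3)) R,
            ‖Real.exp σ • w (Real.exp (2 * σ) * s) (Real.exp σ • y) - w s y‖ ≤ ε) ∧
        (∀ K' : ℝ, K' < Kc → ∀ v : ℝ → EuclideanSpace ℝ (Fin 3) → EuclideanSpace ℝ (Fin 3),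
          IsTypeIAncientMild C v →
          (∀ s : ℝ, s < 0 → ∫⁻ x, ‖fderiv ℝ (v s) x‖ₑ ^ 2 ≤ ENNReal.ofReal (K' / Real.sqrt (-s))) →
          ¬ (∀ r > 0, ∀ M : ℝ, ∃ t ∈ Set.Ioo (-(r ^ 2)) (0 : ℝ),
            ∃ x ∈ Metric.ball (0 : EuclideanSpace ℝ (Fin 3)) r, M < ‖v t x‖)) ∧
        (∀ C' : ℝ, C' < Cs → ∀ v : ℝ → EuclideanSpace ℝ (Fin 3) → EuclideanSpace ℝ (Fin 3),
          IsTypeIAncientMild C' v →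
          (∀ s : ℝ, s < 0 → ∫⁻ x, ‖fderiv ℝ (v s) x‖ₑ ^ 2 ≤ ENNReal.ofReal (Kc / Real.sqrt (-s))) →
          ¬ (∀ r > 0, ∀ M : ℝ, ∃ t ∈ Set.Ioo (-(r ^ 2)) (0 : ℝ),
            ∃ x ∈ Metric.ball (0 : EuclideanSpace ℝ (Fin 3)) r, M < ‖v t x‖)) ∧
        (∀ ε : ℝ, 0 < ε → ∃ Λ : ℝ, 1 < Λ ∧ ∀ τ : ℝ, τ < 0 →
          ∃ t ∈ Set.Icc (Λ ^ 2 * τ) (τ / Λ ^ 2),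
            ENNReal.ofReal ((Kc - ε) / Real.sqrt (-t)) < ∫⁻ x, ‖fderiv ℝ (w t) x‖ₑ ^ 2) := by
  obtain ⟨K₀, hK₀, hgt⟩ := criticalConstant_gt_gap
  refine ⟨K₀, hK₀, fun C K u hu hlaw hsing => ?_⟩
  -- least dissipation constant at `C`, then least Type-I constant at `K_c`
  obtain ⟨Kc, hKcK, ⟨W₁, hW₁, hlawW₁, hsingW₁⟩, hmin⟩ := exists_minimal_singular hu hlaw hsing
  obtain ⟨Cs, h1, hCsC, ⟨W, hW, hlawW, hsingW⟩, hminC⟩ :=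
    exists_minimal_typeI_constant hW₁ hlawW₁ hsingW₁
  -- dissipation-criticality at the smaller constant `C_*`
  have hmin' : ∀ K' : ℝ, K' < Kc → ∀ v : ℝ → EuclideanSpace ℝ (Fin 3) → EuclideanSpace ℝ (Fin 3),
      IsTypeIAncientMild Cs v →
      (∀ s : ℝ, s < 0 → ∫⁻ x, ‖fderiv ℝ (v s) x‖ₑ ^ 2 ≤ ENNReal.ofReal (K' / Real.sqrt (-s))) →
      ¬ (∀ r > 0, ∀ M : ℝ, ∃ t ∈ Set.Ioo (-(r ^ 2)) (0 : ℝ),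
        ∃ x ∈ Metric.ball (0 : EuclideanSpace ℝ (Fin 3)) r, M < ‖v t x‖) :=
    fun K' hK' v hv hlv => hmin K' hK' v (hv.mono_const hCsC) hlv
  -- Birkhoff recurrence in the orbit closure, same constants
  obtain ⟨w, hw, hlaww, hrec, hsingw⟩ :=
    RecurrentReductionD.exists_recurrent_of_persistent_unif hW hlawW
      (fun l hl W' _ hunif _ => RecurrentReductionD.persistent_singularity hW hlawW hsingW l hl W' hunif)
  exact ⟨Kc, Cs, w, hgt Cs Kc w hw hlaww hsingw, hKcK, h1, hCsC, hw, hlaww, hsingw, hrec, hmin,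
    hminC, dissipation_nearMax_of_minimal hmin' hw hlaww hsingw⟩

end Summit.NavierStokesRegularity.NavierStokesRegularity.Theorems.FiniteDissipationLiouville.CriticalElement

end
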